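import Mathlib
import Literature.NumberTheory.Transcendental.AssociatorsCoherenceProofs
import Literature.NumberTheory.Transcendental.AssociatorsLowDegreeProofs
import Literature.NumberTheory.Transcendental.DrinfeldAssociatorRegularisation
import HarnessLib

/-!
# Associators XII: the hexagon in series form and the defect series

Proofs file towards [Furusho2010, Thm 1] (`furusho_pentagon_hexagon`), second step of the
inductive cocycle argument. For a group-like `φ` with `c_X = c_Y = 0` satisfying the 2-cycle
relation `φ(X,Y)φ(Y,X) = 1` (e.g. a solution of the pentagon, [Furusho2010, Lemma 6]) and a
parameter `μ`, the right-hand side of the first hexagon equation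
`φ(t₀₂,t₀₁) e^{μt₀₂/2} φ(t₀₂,t₁₂)⁻¹ e^{μt₁₂/2} φ(t₀₁,t₁₂)` is the value at `(X,Y) = (t₀₂, t₁₂)` of ONE
two-letter series
`𝒢 = φ(X,-X-Y) · e^{μX/2} · φ(Y,X) · e^{μY/2} · φ(-X-Y,Y)`
(Furusho's shift remark `φ(A, B + C) = φ(A, B)` for central `C`, [Furusho2010, proof of Lemma 5],
and the 2-cycle relation), and the left-hand side is the value of `ℰ = e^{μ(X+Y)/2}`; both are
GROUP-LIKE series. Contents:

1. `NCSeries.push_ofFn`, `NCSeries.evalTrunc_push`: the closed formula for the pushforward of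
   `AssociatorsPairing.lean` along a linear substitution of letters and its compatibility with
   substitution into algebras, `(push m φ)(v) = φ(b ↦ Σ_f m(b,f) v(f))`;
2. the substitutions `X ↦ X, Y ↦ -X-Y` (`mXZ`), `X ↦ -X-Y, Y ↦ Y` (`mZY`), `X ↦ X+Y, Y ↦ 0` (`mD`),
   `NCSeries.IsGroupLike.swapXY`;
3. the series `NCSeries.hexG μ φ` (`𝒢`), `NCSeries.hexE μ` (`ℰ`) and the **defect series**
   `NCSeries.hexDefect μ φ = 𝒢 - ℰ`, group-likeness of `𝒢, ℰ`;
4. their values under nilpotent substitutions (`evalTrunc_hexG`, `evalTrunc_hexE`);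
5. **the first hexagon at level `N` in series form** (`NCSeries.hexAt_iff_eval`):
   `HexAt μ φ N ↔ ℰ(t₀₂,t₁₂) = 𝒢(t₀₂,t₁₂)` in `U𝔞₄ ⊗ k/(deg > N)`;
6. consequently (`NCSeries.hexDefect_apply_eq_zero_of_hexAt`) the hexagon at level `N` forces the
   coefficients of the defect series to vanish through degree `N` (projection
   `U𝔞₄ → k⟨⟨X,Y⟩⟩/(deg > N)`, `t₀₂ ↦ X, t₁₂ ↦ Y, t₀₁ ↦ -X-Y`, [Furusho2010, proof of Lemma 7]).

No named facts are introduced.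

## References

* H. Furusho, *Pentagon and hexagon equations*, Ann. of Math. 171 (2010), 545–556, Lemmas 5–7.
  [Furusho2010]
* C. Reutenauer, *Free Lie algebras*, Oxford (1993), §1.4–1.5 (substitutions are bialgebra maps).
  [Reutenauer1993]
-/

noncomputable section

open scoped BigOperators

namespace Literature.NumberTheory.Transcendental

universe u v w

namespace NCSeries

/-! ## 1. The pushforward: closed formula and substitution into algebras -/

section PushEval

variable {α : Type u} {β : Type v} {K : Type w} [CommRing K] [Fintype β]

/-- **Closed formula for the pushforward** on words enumerated as `List.ofFn`:
`c_x(push m φ) = Σ_{|u| = |x|} c_u(φ) ∏ᵢ m(uᵢ, xᵢ)`. [folklore] -/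
theorem push_ofFn (m : β → α → K) : ∀ (n : ℕ) (φ : NCSeries β K) (x : Fin n → α),
    push m φ (List.ofFn x) = ∑ u : Fin n → β, φ (List.ofFn u) * ∏ i, m (u i) (x i)
  | 0, φ, x => by simp
  | n + 1, φ, x => by
    rw [List.ofFn_succ, push_cons,
      ← Fintype.sum_equiv (Fin.consEquiv fun _ => β)
        (fun p : β × (Fin n → β) =>
          φ (List.ofFn (Fin.cons p.1 p.2 : Fin (n + 1) → β)) *
            ∏ i, m ((Fin.cons p.1 p.2 : Fin (n + 1) → β) i) (x i))
        (fun u => φ (List.ofFn u) * ∏ i, m (u i) (x i)) (fun _ => rfl),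
      Fintype.sum_prod_type]
    refine Finset.sum_congr rfl fun b _ => ?_
    rw [push_ofFn m n, Finset.mul_sum]
    refine Finset.sum_congr rfl fun u _ => ?_
    simp only [Fin.prod_univ_succ, Fin.cons_zero, Fin.cons_succ, List.ofFn_succ, lderiv_apply]
    ring

omit [Fintype β] in
/-- **Non-commutative multinomial expansion** of an ordered product of sums. [folklore] -/
theorem prod_ofFn_sum_smul {A : Type*} [Ring A] [Algebra K A] [Fintype α] (m : β → α → K)
    (v : α → A) : ∀ (n : ℕ) (u : Fin n → β),
    (List.ofFn fun i => ∑ f : α, m (u i) f • v f).prod =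
      ∑ x : Fin n → α, (∏ i, m (u i) (x i)) • (List.ofFn fun i => v (x i)).prod
  | 0, u => by simp
  | n + 1, u => by
    rw [List.ofFn_succ, List.prod_cons, prod_ofFn_sum_smul m v n (fun i => u i.succ),
      ← Fintype.sum_equiv (Fin.consEquiv fun _ => α)
        (fun p : α × (Fin n → α) =>
          (∏ i, m (u i) ((Fin.cons p.1 p.2 : Fin (n + 1) → α) i)) •
            (List.ofFn fun i => v ((Fin.cons p.1 p.2 : Fin (n + 1) → α) i)).prod)
        (fun x => (∏ i, m (u i) (x i)) • (List.ofFn fun i => v (x i)).prod) (fun _ => rfl),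
      Fintype.sum_prod_type, Finset.sum_mul]
    refine Finset.sum_congr rfl fun f _ => ?_
    rw [Finset.mul_sum]
    refine Finset.sum_congr rfl fun x _ => ?_
    simp only [Fin.prod_univ_succ, Fin.cons_zero, Fin.cons_succ, List.ofFn_succ, List.prod_cons]
    rw [smul_mul_assoc, mul_smul_comm, smul_smul]

/-- **Pushforward and substitution**: `(push m φ)(v) = φ(b ↦ Σ_f m(b, f) v(f))` weight by weight
— the pushforward along a linear substitution of letters followed by a substitution into an
algebra is the composite substitution. [cite: Reutenauer1993, §1.4] -/
theorem evalTrunc_push {A : Type*} [Ring A] [Algebra K A] [Fintype α] (N : ℕ) (m : β → α → K)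
    (v : α → A) (φ : NCSeries β K) :
    evalTrunc N v (push m φ) = evalTrunc N (fun b => ∑ f : α, m b f • v f) φ := by
  unfold evalTrunc
  refine Finset.sum_congr rfl fun n _ => ?_
  simp_rw [List.map_ofFn]
  calc ∑ x : Fin n → α, push m φ (List.ofFn x) • (List.ofFn (v ∘ x)).prod
      = ∑ x : Fin n → α, ∑ u : Fin n → β,
          (φ (List.ofFn u) * ∏ i, m (u i) (x i)) • (List.ofFn (v ∘ x)).prod := by
        refine Finset.sum_congr rfl fun x _ => ?_
        rw [push_ofFn, Finset.sum_smul]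
    _ = ∑ u : Fin n → β, ∑ x : Fin n → α,
          (φ (List.ofFn u) * ∏ i, m (u i) (x i)) • (List.ofFn (v ∘ x)).prod := Finset.sum_comm
    _ = ∑ u : Fin n → β, φ (List.ofFn u) • (List.ofFn ((fun b => ∑ f, m b f • v f) ∘ u)).prod := by
        refine Finset.sum_congr rfl fun u _ => ?_
        rw [show List.ofFn ((fun b => ∑ f, m b f • v f) ∘ u) =
            List.ofFn (fun i => ∑ f, m (u i) f • v f) from rfl, prod_ofFn_sum_smul, Finset.smul_sum]
        refine Finset.sum_congr rfl fun x _ => ?_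
        rw [mul_smul]
        rfl

end PushEval

/-! ## 2. Three linear substitutions of the two letters; `φ(Y,X)` is group-like -/

section Subst

variable {k : Type u} [CommRing k]

/-- The substitution `X ↦ X, Y ↦ -X - Y` as a letter matrix. [folklore] -/
def mXZ : Bool → Bool → k := fun b f => if b then -1 else if f then 0 else 1

/-- The substitution `X ↦ -X - Y, Y ↦ Y` as a letter matrix. [folklore] -/
def mZY : Bool → Bool → k := fun b f => if b then (if f then 1 else 0) else -1

/-- The substitution `X ↦ X + Y, Y ↦ 0` as a letter matrix. [folklore] -/
def mD : Bool → Bool → k := fun b _ => if b then 0 else 1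

variable {A : Type*} [Ring A] [Algebra k A]

/-- `(push mXZ φ)(a, b) = φ(a, -a-b)`. [folklore] -/
theorem evalTrunc_push_mXZ (N : ℕ) (a b : A) (φ : NCSeries Bool k) :
    evalTrunc N (bsub a b) (push mXZ φ) = evalTrunc N (bsub a (-a - b)) φ := by
  rw [evalTrunc_push]
  congr 1
  funext c
  cases c
  · simp [mXZ, bsub]
  · simp [mXZ, bsub]; abel

/-- `(push mZY φ)(a, b) = φ(-a-b, b)`. [folklore] -/
theorem evalTrunc_push_mZY (N : ℕ) (a b : A) (φ : NCSeries Bool k) :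
    evalTrunc N (bsub a b) (push mZY φ) = evalTrunc N (bsub (-a - b) b) φ := by
  rw [evalTrunc_push]
  congr 1
  funext c
  cases c
  · simp [mZY, bsub]; abel
  · simp [mZY, bsub]

/-- `(push mD φ)(a, b) = φ(a + b, 0)`. [folklore] -/
theorem evalTrunc_push_mD (N : ℕ) (a b : A) (φ : NCSeries Bool k) :
    evalTrunc N (bsub a b) (push mD φ) = evalTrunc N (bsub (a + b) 0) φ := by
  rw [evalTrunc_push]
  congr 1
  funext c
  cases c
  · simp [mD, bsub]; abel
  · simp [mD, bsub]

/-- **`φ(Y,X)` is group-like when `φ` is** (exchanging the letters is a bialgebra automorphism).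
[folklore] -/
theorem IsGroupLike.swapXY {φ : NCSeries Bool k} (hg : IsGroupLike φ) : IsGroupLike (swapXY φ) := by
  refine ⟨by simpa using hg.1, fun u v => ?_⟩
  rw [swapXY_apply, swapXY_apply, hg.2 (u.map not) (v.map not), shuffleWord_map_not, List.map_map]
  rfl

/-- A one-letter monomial is a multiple of the letter. [folklore] -/
theorem monomial_singleton_eq_smul (a : Bool) (c : k) :
    (monomial [a] c : NCSeries Bool k) = c • letter a := by
  ext w
  by_cases h : w = [a] <;> simp [monomial, letter, h]

/-- `exp(c X_a)` is group-like. [folklore] -/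
theorem isGroupLike_exp_monomial [Algebra ℚ k] (a : Bool) (c : k) :
    IsGroupLike (exp (monomial [a] c) : NCSeries Bool k) := by
  have h := Shuffle.isGroupLike_expLetter (K := k) a c
  rwa [Shuffle.expLetter_eq_exp] at h

end Subst

/-! ## 3. The series `𝒢`, `ℰ` and the defect series -/

section Series

variable {k : Type u} [CommRing k] [Algebra ℚ k]

/-- **`𝒢 = φ(X,-X-Y) e^{μX/2} φ(Y,X) e^{μY/2} φ(-X-Y,Y)`**, the right-hand side of the first
hexagon as a two-letter series (the exponentials as `NCSeries.exp` of `(μ/2)·X`, `(μ/2)·Y`).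
[cite: Furusho2010, Lemma 7] -/
def hexG (μ : k) (φ : NCSeries Bool k) : NCSeries Bool k :=
  push mXZ φ * exp (monomial [false] ((1 / 2 : ℚ) • μ)) * swapXY φ *
    exp (monomial [true] ((1 / 2 : ℚ) • μ)) * push mZY φ

/-- **`ℰ = e^{μ(X+Y)/2}`**, the left-hand side of the first hexagon as a two-letter series.
[cite: Furusho2010, Lemma 7] -/
def hexE (μ : k) : NCSeries Bool k := push mD (exp (monomial [false] ((1 / 2 : ℚ) • μ)))

/-- **The defect series** of the first hexagon: `𝒢 - ℰ`. [folklore] -/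
def hexDefect (μ : k) (φ : NCSeries Bool k) : NCSeries Bool k := hexG μ φ - hexE μ

/-- `𝒢` is group-like for group-like `φ`. [folklore] -/
theorem isGroupLike_hexG (μ : k) {φ : NCSeries Bool k} (hg : IsGroupLike φ) :
    IsGroupLike (hexG μ φ) :=
  ((((hg.push mXZ).mul (isGroupLike_exp_monomial false _)).mul hg.swapXY).mul
    (isGroupLike_exp_monomial true _)).mul (hg.push mZY)

/-- `ℰ` is group-like. [folklore] -/
theorem isGroupLike_hexE (μ : k) : IsGroupLike (hexE μ : NCSeries Bool k) :=
  (isGroupLike_exp_monomial false _).push mD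

/-- Coefficients of the defect series. [folklore] -/
theorem hexDefect_apply (μ : k) (φ : NCSeries Bool k) (w : List Bool) :
    hexDefect μ φ w = hexG μ φ w - hexE μ w := rfl

end Series

/-! ## 4. Values under nilpotent substitutions -/

section Values

variable {k : Type u} [CommRing k] [Algebra ℚ k] {A : Type*} [Ring A] [Algebra k A]

omit [Algebra ℚ k] in
/-- Nilpotency of two-letter substitutions with values in a submodule all of whose long products
vanish. [folklore] -/
theorem prod_map_bsub_eq_zero_of_mem {N : ℕ} (S : Submodule k A)
    (hS : ∀ L : List A, (∀ y ∈ L, y ∈ S) → N < L.length → L.prod = 0) {a b : A} (ha : a ∈ S)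
    (hb : b ∈ S) (w : List Bool) (hw : N < w.length) : (w.map (bsub a b)).prod = 0 :=
  hS _ (fun y hy => by
    obtain ⟨c, -, rfl⟩ := List.mem_map.mp hy
    cases c
    · exact ha
    · exact hb) (by simpa using hw)

/-- `(exp(c X))(a, b) = e^{c a}` (truncated exponential), for nilpotent substitutions. [folklore] -/
theorem evalTrunc_exp_monomial_false {N : ℕ} (S : Submodule k A)
    (hS : ∀ L : List A, (∀ y ∈ L, y ∈ S) → N < L.length → L.prod = 0) {a b : A} (ha : a ∈ S)
    (hb : b ∈ S) (c : k) :
    evalTrunc N (bsub a b) (exp (monomial [false] c)) = truncExp k N (c • a) := by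
  have hv := prod_map_bsub_eq_zero_of_mem S hS ha hb
  rw [evalTrunc_exp N _ hv (by simp), monomial_singleton_eq_smul, evalTrunc_smul,
    evalTrunc_letter N _ hv]
  rfl

/-- `(exp(c Y))(a, b) = e^{c b}`. [folklore] -/
theorem evalTrunc_exp_monomial_true {N : ℕ} (S : Submodule k A)
    (hS : ∀ L : List A, (∀ y ∈ L, y ∈ S) → N < L.length → L.prod = 0) {a b : A} (ha : a ∈ S)
    (hb : b ∈ S) (c : k) :
    evalTrunc N (bsub a b) (exp (monomial [true] c)) = truncExp k N (c • b) := by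
  have hv := prod_map_bsub_eq_zero_of_mem S hS ha hb
  rw [evalTrunc_exp N _ hv (by simp), monomial_singleton_eq_smul, evalTrunc_smul,
    evalTrunc_letter N _ hv]
  rfl

/-- **`ℰ(a, b) = e^{μ(a+b)/2}`.** [folklore] -/
theorem evalTrunc_hexE {N : ℕ} (S : Submodule k A)
    (hS : ∀ L : List A, (∀ y ∈ L, y ∈ S) → N < L.length → L.prod = 0) {a b : A} (ha : a ∈ S)
    (hb : b ∈ S) (μ : k) :
    evalTrunc N (bsub a b) (hexE μ) = truncExp k N (((1 / 2 : ℚ) • μ) • (a + b)) := by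
  rw [hexE, evalTrunc_push_mD,
    evalTrunc_exp_monomial_false S hS (Submodule.add_mem _ ha hb) (Submodule.zero_mem _)]

/-- **`𝒢(a, b) = φ(a,-a-b) e^{μa/2} φ(b,a) e^{μb/2} φ(-a-b,b)`.** [folklore] -/
theorem evalTrunc_hexG {N : ℕ} (S : Submodule k A)
    (hS : ∀ L : List A, (∀ y ∈ L, y ∈ S) → N < L.length → L.prod = 0) {a b : A} (ha : a ∈ S)
    (hb : b ∈ S) (μ : k) (φ : NCSeries Bool k) :
    evalTrunc N (bsub a b) (hexG μ φ) =
      evalTrunc N (bsub a (-a - b)) φ * truncExp k N (((1 / 2 : ℚ) • μ) • a) *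
          evalTrunc N (bsub b a) φ * truncExp k N (((1 / 2 : ℚ) • μ) • b) *
        evalTrunc N (bsub (-a - b) b) φ := by
  have hv := prod_map_bsub_eq_zero_of_mem S hS ha hb
  rw [hexG, evalTrunc_mul N _ hv, evalTrunc_mul N _ hv, evalTrunc_mul N _ hv, evalTrunc_mul N _ hv,
    evalTrunc_push_mXZ, evalTrunc_exp_monomial_false S hS ha hb, evalTrunc_swapXY,
    evalTrunc_exp_monomial_true S hS ha hb, evalTrunc_push_mZY]

/-- The defect series evaluates to the difference. [folklore] -/
theorem evalTrunc_hexDefect (N : ℕ) (v : Bool → A) (μ : k) (φ : NCSeries Bool k) :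
    evalTrunc N v (hexDefect μ φ) = evalTrunc N v (hexG μ φ) - evalTrunc N v (hexE μ) := by
  rw [hexDefect, sub_eq_add_neg, evalTrunc_add, ← neg_one_smul k (hexE μ), evalTrunc_smul,
    neg_one_smul, ← sub_eq_add_neg]

end Values

/-! ## 5. The first hexagon at level `N` in series form -/

section HexSeries

variable {k : Type u} [CommRing k] [Algebra ℚ k] {N : ℕ}

local notation "𝔱" => (DrinfeldKohnoTrunc.t k N : Fin 4 → Fin 4 → DrinfeldKohnoTrunc k (Fin 4) N)

omit [Algebra ℚ k] in
/-- Long products of weight-one elements of `U𝔞₄ ⊗ k/(deg > N)` vanish (the hypothesis `hS` of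
§4 for `S = genSpan`). [folklore] -/
theorem genSpan_prod_eq_zero :
    ∀ L : List (DrinfeldKohnoTrunc k (Fin 4) N),
      (∀ y ∈ L, y ∈ (DrinfeldKohnoTrunc.genSpan : Submodule k (DrinfeldKohnoTrunc k (Fin 4) N))) →
        N < L.length → L.prod = 0 :=
  fun L hL hlen => DrinfeldKohnoTrunc.list_prod_eq_zero_of_mem_genSpan L hL hlen

omit [Algebra ℚ k] in
/-- The central element `t₀₁ + t₀₂ + t₁₂` of the three-strand subalgebra commutes with `t₀₂`.
[folklore] -/
theorem commute_c012_t02 : Commute (𝔱 0 1 + 𝔱 0 2 + 𝔱 1 2) (𝔱 0 2) := by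
  have h : Commute (𝔱 0 1 + 𝔱 1 2) (𝔱 0 2) := DrinfeldKohnoTrunc.commute_t02_t01_add_t12.symm
  have e : 𝔱 0 1 + 𝔱 0 2 + 𝔱 1 2 = (𝔱 0 1 + 𝔱 1 2) + 𝔱 0 2 := by abel
  rw [e]
  exact h.add_left (Commute.refl _)

omit [Algebra ℚ k] in
/-- The central element `t₀₁ + t₀₂ + t₁₂` commutes with `t₁₂`. [folklore] -/
theorem commute_c012_t12 : Commute (𝔱 0 1 + 𝔱 0 2 + 𝔱 1 2) (𝔱 1 2) := by
  have h : Commute (𝔱 0 1 + 𝔱 0 2) (𝔱 1 2) := DrinfeldKohnoTrunc.commute_t12_t01_add_t02.symm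
  exact h.add_left (Commute.refl _)

/-- **The right-hand side of the first hexagon is `𝒢(t₀₂, t₁₂)`**, for a group-like `φ` with
`c_X = c_Y = 0` satisfying the 2-cycle relation: Furusho's shift `φ(A, B + C) = φ(A, B)` for
central `C` turns `φ(t₀₂, t₀₁)` into `φ(t₀₂, -t₀₂-t₁₂)` and `φ(t₀₁, t₁₂)` into
`φ(-t₀₂-t₁₂, t₁₂)` (`t₀₁ + t₀₂ + t₁₂` is central in the three-strand subalgebra), and the 2-cycle
relation turns `φ(t₀₂,t₁₂)⁻¹` into `φ(t₁₂,t₀₂)`. [cite: Furusho2010, Lemma 7] -/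
theorem hexagon_rhs_eq_evalTrunc_hexG {φ : NCSeries Bool k} (hg : IsGroupLike φ)
    (h0 : φ [false] = 0) (h1 : φ [true] = 0) (h2 : φ * swapXY φ = 1 ∧ swapXY φ * φ = 1) (μ : k) :
    evalTrunc N (bsub (𝔱 0 2) (𝔱 0 1)) φ *
            DrinfeldKohnoTrunc.expT (((1 / 2 : ℚ) • μ) • 𝔱 0 2) *
          Ring.inverse (evalTrunc N (bsub (𝔱 0 2) (𝔱 1 2)) φ) *
        DrinfeldKohnoTrunc.expT (((1 / 2 : ℚ) • μ) • 𝔱 1 2) *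
      evalTrunc N (bsub (𝔱 0 1) (𝔱 1 2)) φ =
    evalTrunc N (bsub (𝔱 0 2) (𝔱 1 2)) (hexG μ φ) := by
  have m02 := DrinfeldKohnoTrunc.t_mem_genSpan (R := k) (N := N) (0 : Fin 4) 2
  have m12 := DrinfeldKohnoTrunc.t_mem_genSpan (R := k) (N := N) (1 : Fin 4) 2
  rw [evalTrunc_hexG _ genSpan_prod_eq_zero m02 m12, DrinfeldKohnoTrunc.expT_eq_truncExp,
    DrinfeldKohnoTrunc.expT_eq_truncExp]
  have hc1 : Commute (𝔱 0 1 + 𝔱 0 2 + 𝔱 1 2) (𝔱 0 2) := commute_c012_t02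
  have hc2 : Commute (𝔱 0 1 + 𝔱 0 2 + 𝔱 1 2) (𝔱 1 2) := commute_c012_t12
  have hcZ : Commute (𝔱 0 1 + 𝔱 0 2 + 𝔱 1 2) (-𝔱 0 2 - 𝔱 1 2) :=
    (hc1.neg_right).sub_right hc2
  -- the first factor
  have e1 : evalTrunc N (bsub (𝔱 0 2) (𝔱 0 1)) φ = evalTrunc N (bsub (𝔱 0 2) (-𝔱 0 2 - 𝔱 1 2)) φ := by
    rw [show (𝔱 0 1) = (-𝔱 0 2 - 𝔱 1 2) + (𝔱 0 1 + 𝔱 0 2 + 𝔱 1 2) by abel]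
    exact hg.evalTrunc_bsub_add_right h1 N hc1 hcZ
  -- the last factor
  have e5 : evalTrunc N (bsub (𝔱 0 1) (𝔱 1 2)) φ = evalTrunc N (bsub (-𝔱 0 2 - 𝔱 1 2) (𝔱 1 2)) φ := by
    rw [show (𝔱 0 1) = (-𝔱 0 2 - 𝔱 1 2) + (𝔱 0 1 + 𝔱 0 2 + 𝔱 1 2) by abel]
    exact hg.evalTrunc_bsub_add_left h0 N hcZ hc2
  -- the inverse
  have hv := prod_map_bsub_eq_zero_of_mem _ genSpan_prod_eq_zero m02 m12
  have e3 : Ring.inverse (evalTrunc N (bsub (𝔱 0 2) (𝔱 1 2)) φ) = evalTrunc N (bsub (𝔱 1 2) (𝔱 0 2)) φ :=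
    ring_inverse_eq_of_mul_eq_one (two_cycle_eval h2 N hv).1 (two_cycle_eval h2 N hv).2
  rw [e1, e5, e3]

/-- **The left-hand side of the first hexagon is `ℰ(t₀₂, t₁₂)`.** [folklore] -/
theorem hexagon_lhs_eq_evalTrunc_hexE (μ : k) :
    DrinfeldKohnoTrunc.expT (((1 / 2 : ℚ) • μ) • (𝔱 0 2 + 𝔱 1 2)) =
      evalTrunc N (bsub (𝔱 0 2) (𝔱 1 2)) (hexE μ) := by
  rw [evalTrunc_hexE _ genSpan_prod_eq_zero (DrinfeldKohnoTrunc.t_mem_genSpan 0 2)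
    (DrinfeldKohnoTrunc.t_mem_genSpan 1 2), DrinfeldKohnoTrunc.expT_eq_truncExp]

/-- **The first hexagon at level `N` in series form**: `HexAt μ φ N ↔ ℰ(t₀₂,t₁₂) = 𝒢(t₀₂,t₁₂)`.
[cite: Furusho2010, Lemma 7] -/
theorem hexAt_iff_eval {φ : NCSeries Bool k} (hg : IsGroupLike φ) (h0 : φ [false] = 0)
    (h1 : φ [true] = 0) (h2 : φ * swapXY φ = 1 ∧ swapXY φ * φ = 1) (μ : k) :
    HexAt μ φ N ↔
      evalTrunc N (bsub (𝔱 0 2) (𝔱 1 2)) (hexE μ) = evalTrunc N (bsub (𝔱 0 2) (𝔱 1 2)) (hexG μ φ) := by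
  unfold HexAt
  dsimp only [subst₂, t₄]
  rw [hexagon_rhs_eq_evalTrunc_hexG hg h0 h1 h2 μ, hexagon_lhs_eq_evalTrunc_hexE μ]

/-- Equivalently: the defect series evaluates to `0` at `(t₀₂, t₁₂)`. [folklore] -/
theorem hexAt_iff_evalTrunc_hexDefect {φ : NCSeries Bool k} (hg : IsGroupLike φ) (h0 : φ [false] = 0)
    (h1 : φ [true] = 0) (h2 : φ * swapXY φ = 1 ∧ swapXY φ * φ = 1) (μ : k) :
    HexAt μ φ N ↔ evalTrunc N (bsub (𝔱 0 2) (𝔱 1 2)) (hexDefect μ φ) = 0 := by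
  rw [hexAt_iff_eval hg h0 h1 h2 μ, evalTrunc_hexDefect, sub_eq_zero, eq_comm]

end HexSeries

/-! ## 6. The hexagon at level `N` kills the defect coefficients through degree `N` -/

section LowVanishing

variable {k : Type u} [CommRing k] [Algebra ℚ k] {N : ℕ}

local notation "𝔱" => (DrinfeldKohnoTrunc.t k N : Fin 4 → Fin 4 → DrinfeldKohnoTrunc k (Fin 4) N)

/-- The projection `U𝔞₄ ⊗ k/(deg > N) → k⟨⟨X,Y⟩⟩/(deg > N)` with `t₀₂ ↦ X`, `t₁₂ ↦ Y`
(`t₀₁ ↦ -X-Y`, `t_{i3}` accordingly): `projQ` with labels `(P, Q) = (-X-Y, Y)`. [folklore] -/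
def projXY (N : ℕ) : DrinfeldKohnoTrunc k (Fin 4) N →ₐ[k] (NCSeries Bool k ⧸ truncIdeal Bool k N) :=
  projQ k N (-X₀ - X₁) X₁ (by simp) (by simp)

omit [Algebra ℚ k] in
/-- `projXY t₀₂ = [X]`. [folklore] -/
theorem projXY_t02 : projXY N (𝔱 0 2) = Ideal.Quotient.mk (truncIdeal Bool k N) X₀ := by
  unfold projXY
  rw [show (𝔱 0 2) = t₄ k N 0 2 from rfl, projQ_t,
    show qLab (-X₀ - X₁ : NCSeries Bool k) X₁ ((0 : Fin 4) : ℕ) ((2 : Fin 4) : ℕ) = -(-X₀ - X₁) - X₁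
      from rfl]
  congr 1
  abel

omit [Algebra ℚ k] in
/-- `projXY t₁₂ = [Y]`. [folklore] -/
theorem projXY_t12 : projXY N (𝔱 1 2) = Ideal.Quotient.mk (truncIdeal Bool k N) X₁ := by
  unfold projXY
  rw [show (𝔱 1 2) = t₄ k N 1 2 from rfl, projQ_t,
    show qLab (-X₀ - X₁ : NCSeries Bool k) X₁ ((1 : Fin 4) : ℕ) ((2 : Fin 4) : ℕ) = X₁ from rfl]

/-- **The hexagon at level `N` forces `c_w(𝒢 - ℰ) = 0` for `|w| ≤ N`**: project
`𝒢(t₀₂,t₁₂) = ℰ(t₀₂,t₁₂)` to `k⟨⟨X,Y⟩⟩/(deg > N)`, where it reads `[𝒢] = [ℰ]`.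
[cite: Furusho2010, Lemma 7] -/
theorem hexDefect_apply_eq_zero_of_hexAt {φ : NCSeries Bool k} (hg : IsGroupLike φ)
    (h0 : φ [false] = 0) (h1 : φ [true] = 0) (h2 : φ * swapXY φ = 1 ∧ swapXY φ * φ = 1) {μ : k}
    (hH : HexAt μ φ N) {w : List Bool} (hw : w.length ≤ N) : hexDefect μ φ w = 0 := by
  rw [hexAt_iff_evalTrunc_hexDefect hg h0 h1 h2 μ] at hH
  have h := congrArg (projXY N) hH
  rw [map_zero, algHom_evalTrunc_bsub, projXY_t02, projXY_t12, ← mk_evalTrunc, mk_evalTrunc_X₀_X₁,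
    Ideal.Quotient.eq_zero_iff_mem, mem_truncIdeal] at h
  exact h w hw

/-- In particular, if the first hexagon holds at all levels `< m`, the defect series has no terms
of degree `< m`. [folklore] -/
theorem hexDefect_apply_eq_zero_of_forall_lt {φ : NCSeries Bool k} (hg : IsGroupLike φ)
    (h0 : φ [false] = 0) (h1 : φ [true] = 0) (h2 : φ * swapXY φ = 1 ∧ swapXY φ * φ = 1) {μ : k}
    {m : ℕ} (hH : ∀ N : ℕ, N < m → HexAt μ φ N) {w : List Bool} (hw : w.length < m) :
    hexDefect μ φ w = 0 := by
  rcases Nat.eq_zero_or_pos m with hm | hm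
  · omega
  · exact hexDefect_apply_eq_zero_of_hexAt (N := m - 1) hg h0 h1 h2 (hH (m - 1) (by omega)) (by omega)

end LowVanishing

end NCSeries

end Literature.NumberTheory.Transcendental
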